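import Summits.RiemannHypothesis.RiemannHypothesis.Theses.SignCone

/-!
# Gap-count ladder of the sign-cone criterion: vocabulary (`SingleGapAt`, `GapRung`)
(crux `SignConeInequality`, item stmt-RiemannHypothesis-16301; cell `Cruxes/SignConeInequality/`, rung `GapRung 1`)

The banked criterion `SignConeInequality ↔ RiemannHypothesis` (`signConeInequality_iff_riemannHypothesis`) has a
GAP-COUNT grading (crux strategist r2, `Cruxes/SignConeInequality/DECOMPOSITION-r2.md` §R2.1, family L2): rung `m` is the
unit-slack prime-free inequality `-Re F(0) ≤ Re W_ar(F)` for node-nonnegative autocorrelation sums `F = Σᵢ gᵢ ⋆ g̃ᵢ`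
(any cutoff) whose far-field negativity `{ |t| ≥ log 2, Re F(t) < 0 }` meets at most `m` node gaps `[log n, log (n+1))`.
Rung `0` is the closed far-field item `SignConeFarField` (stmt-RiemannHypothesis-16305); `∀ m, GapRung m` is the crux
(finite gap count from `supp F ⊆ [-2a, 2a]`).  The ladder seat (`planner-fwd-ladder-RiemannHypothesis-16301-0`, line
`gap-rung-one`, 2026-08-17T15:04Z) registered rung `1` as three regime stubs over the single-gap statement
`SingleGapAt n₀ a` (`stub_gap_small` `2 ≤ n₀ ≤ 11`, `stub_gap_mid` `12 ≤ n₀ ≤ 112`, `stub_gap_large` `113 ≤ n₀`).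

This file gives the two definitions, VERBATIM in the route's Mathlib-only vocabulary (cone note rev 3: the body is the
route decl `SignConeInequality` at one cutoff with one extra hypothesis; `F`, `M` are the same `let`-binders), so that
`--supports` files can prove the registered stubs against literally these terms (precedent:
`SignConeSignConeOscillatoryDualWitnessDefs`).  `GapRung m` is the strategist's `StrategistR2Probes.GapRung{One,Two,FiftyFour}`
with the gap count `m` as a parameter; `SingleGapAt n₀ a` is its `s = {n₀}` instance at cutoff `a`.
-/

noncomputable section

-- `Summit.RiemannHypothesis.RiemannHypothesis.…` repeats a namespace component by design (D-0017 layout).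
set_option linter.dupNamespace false

open scoped BigOperators ComplexConjugate

namespace Summit.RiemannHypothesis.RiemannHypothesis.Theorems.SignCone

/-- **Single-gap statement at node gap `n₀` and cutoff `a`.** For every finite family of smooth tests `gᵢ` supported in
`[-a, a]` with autocorrelation sum `F = Σᵢ gᵢ ⋆ g̃ᵢ` that is non-negative at the nodes (`Re F(log n) ≥ 0`, `n ≥ 2`) and
whose far-field negativity is confined to the one node gap `log n₀ ≤ |t| < log (n₀ + 1)`, the unit-slack prime-free
inequality `-Re F(0) ≤ Re (M 0 + M 1 + (1/2π) ∫ M(1/2+it) Re ψ(1/4 + it/2) dt − F(0) log π)` holds. [folklore] -/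
def SingleGapAt (n₀ : ℕ) (a : ℝ) : Prop :=
  ∀ (k : ℕ) (g : Fin k → ℝ → ℂ), (∀ i, (ContDiff ℝ ((⊤ : ℕ∞) : WithTop ℕ∞) (g i) ∧ HasCompactSupport (g i)) ∧ tsupport (g i) ⊆ Set.Icc (-a) a) → let F : ℝ → ℂ := fun t => ∑ i, MeasureTheory.convolution (g i) (fun u => (starRingEnd ℂ) ((g i) (-u))) (ContinuousLinearMap.mul ℂ ℂ) MeasureTheory.MeasureSpace.volume t; (∀ n : ℕ, 2 ≤ n → 0 ≤ (F (Real.log n)).re) → (∀ t : ℝ, Real.log 2 ≤ |t| → (F t).re < 0 → Real.log n₀ ≤ |t| ∧ |t| < Real.log (n₀ + 1)) → let M : ℂ → ℂ := fun s => ∫ u : ℝ, F u * Complex.exp ((s - 1 / 2) * u); -(F 0).re ≤ (M 0 + M 1 + ((1 / (2 * Real.pi) : ℂ) * (∫ t : ℝ, M (1 / 2 + t * Complex.I) * ((Complex.digamma (1 / 4 + t / 2 * Complex.I)).re : ℂ)) - F 0 * (Real.log Real.pi : ℂ))).re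

/-- **Rung `m` of the gap-count ladder** (`X^{(m)}`): the unit-slack prime-free inequality at every cutoff for
node-nonnegative autocorrelation sums whose far-field negativity lies in at most `m` node gaps `[log n, log (n+1))`
(witnessed by a finite set `s` of gap indices with `s.card ≤ m`).  `GapRung 0` is `SignConeFarField`;
`∀ m, GapRung m` is `SignConeInequality`. [folklore] -/
def GapRung (m : ℕ) : Prop :=
  ∀ a : ℝ, 0 < a → ∀ (k : ℕ) (g : Fin k → ℝ → ℂ), (∀ i, (ContDiff ℝ ((⊤ : ℕ∞) : WithTop ℕ∞) (g i) ∧ HasCompactSupport (g i)) ∧ tsupport (g i) ⊆ Set.Icc (-a) a) → let F : ℝ → ℂ := fun t => ∑ i, MeasureTheory.convolution (g i) (fun u => (starRingEnd ℂ) ((g i) (-u))) (ContinuousLinearMap.mul ℂ ℂ) MeasureTheory.MeasureSpace.volume t; (∀ n : ℕ, 2 ≤ n → 0 ≤ (F (Real.log n)).re) → (∃ s : Finset ℕ, s.card ≤ m ∧ ∀ t : ℝ, Real.log 2 ≤ |t| → (F t).re < 0 → ∃ n ∈ s, Real.log n ≤ |t| ∧ |t| < Real.log (n + 1)) → let M :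 ℂ → ℂ := fun s => ∫ u : ℝ, F u * Complex.exp ((s - 1 / 2) * u); -(F 0).re ≤ (M 0 + M 1 + ((1 / (2 * Real.pi) : ℂ) * (∫ t : ℝ, M (1 / 2 + t * Complex.I) * ((Complex.digamma (1 / 4 + t / 2 * Complex.I)).re : ℂ)) - F 0 * (Real.log Real.pi : ℂ))).re

end Summit.RiemannHypothesis.RiemannHypothesis.Theorems.SignCone

end
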